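import Summits.BirchSwinnertonDyer.BirchSwinnertonDyer.Theorems.ManinLocalTwoThreeTriplingProfileIstarZero
import HarnessLib

/-!
# A tripled class at `N = 9p` with `X₀`-optimal curve of type `I₀*` triples along a `3`-line that is NOT generated by a rational point

Summit `BirchSwinnertonDyer`, route `ManinLocalTwoThree` (cell bsd-f2-manin), deciding crux C3 `ManinPrimeToThreeAtNine`
(stmt-BirchSwinnertonDyer-22968).  p653633 (`tripling_profile_IstarZero_nine_mul_prime`): tripled ∧ `ord₃ Δ_min(W₀) = 6` ⟹ the Vélu line `q` of
p3-g6's rigidity has `ord₃ D₀(q) = 3` — ODD.  A rational `3`-torsion POINT `(X₁, Y₁)` of `E_{W,1}` has `D₀(X₁) = 4Y₁²`, of EVEN `3`-order.  Hence: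

* `Ψ₂Sq_eval_eq_four_mul_sq_of_isShortThreeTorsion` — `D₀ = 4Y₁²` at a rational `3`-torsion point;
* `even_padicValRat_Ψ₂Sq_of_isShortThreeTorsion` — its `3`-order is even;
* `veluLine_not_isShortThreeTorsion_of_tripled_IstarZero` — at `N = 9p` (`p ≡ 2 (3)`, `exists_isNewformOf`), tripled with `W₀` of type `I₀*`:
  the tripling line `q` carries NO rational point of `E_{W₀,1}` (`∀ Y₁, ¬ IsShortThreeTorsion W₀ 1 q Y₁`) — the kernel of `W₀ → W₁` is a
  rational LINE with non-rational points (as for the Shimura `μ₃`-kernels of MEMO-an §68).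

HONEST FRAMING: C3, Manin's conjecture and BSD are not proved.  No definitions, no named facts, no sorry.
References: [CesnaviciusNeururerSaha2023] Lemma 6.5; [SilvermanATAEC1994] IV.9.4 Table 4.1; HOME/MEMO-an.md §66, §68.
-/

set_option linter.dupNamespace false
set_option autoImplicit false

noncomputable section

open scoped Classical

open WeierstrassCurve Polynomial CongruenceSubgroup
  Literature.NumberTheory.EllipticCurves Literature.NumberTheory.EllipticCurves.ModularForms
  Summit.BirchSwinnertonDyer.Rank1Residual.ManinAdditive.CuspidalKummer
  Summit.BirchSwinnertonDyer.Rank1Residual.ManinAdditive.CuspidalKummerThree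

namespace Summit.BirchSwinnertonDyer.BirchSwinnertonDyer.Theorems.ManinLocalTwoThree

/-- `D₀ = 4Y₁²` at a rational `3`-torsion point `(X₁, Y₁)` of the short model `E_{W,1}`. [folklore] -/
theorem Ψ₂Sq_eval_eq_four_mul_sq_of_isShortThreeTorsion (W : WeierstrassCurve ℚ) {X₁ Y₁ : ℚ} (hT : IsShortThreeTorsion W 1 X₁ Y₁) :
    W.Ψ₂Sq.eval (X₁ - W.b₂ / 12) = 4 * Y₁ ^ 2 := by
  have heq := equation_of_isShortThreeTorsion hT
  have ha₄ : (shortModel W 1).a₄ = -W.c₄ / 48 := by simp [shortModel]; ring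
  have ha₆ : (shortModel W 1).a₆ = -W.c₆ / 864 := by simp [shortModel]; ring
  rw [ha₄, ha₆] at heq
  rw [Ψ₂Sq_eval_sub_b₂_div_twelve_explicit]
  linear_combination (-4 : ℚ) * heq

/-- The `3`-order of `D₀` at a rational `3`-torsion point is EVEN (`D₀ = 4Y₁²`, `Y₁ ≠ 0`). [folklore] -/
theorem even_padicValRat_Ψ₂Sq_of_isShortThreeTorsion (W : WeierstrassCurve ℚ) {X₁ Y₁ : ℚ} (hT : IsShortThreeTorsion W 1 X₁ Y₁) :
    Even (padicValRat 3 (W.Ψ₂Sq.eval (X₁ - W.b₂ / 12))) := by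
  haveI : Fact (Nat.Prime 3) := ⟨Nat.prime_three⟩
  have hY := y_ne_zero_of_isShortThreeTorsion hT
  rw [Ψ₂Sq_eval_eq_four_mul_sq_of_isShortThreeTorsion W hT, padicValRat.mul (by norm_num) (pow_ne_zero _ hY), padicValRat.pow Y₁]
  have h4 : padicValRat 3 (4 : ℚ) = 0 := by
    rw [show (4 : ℚ) = ((4 : ℕ) : ℚ) by norm_num, padicValRat.of_nat]; norm_num [padicValNat.eq_zero_of_not_dvd]
  rw [h4]
  exact ⟨padicValRat 3 Y₁, by ring⟩

variable {W₁ W₀ : WeierstrassCurve ℚ} [W₁.IsElliptic] [W₁.IsGloballyMinimal] [W₀.IsElliptic] [W₀.IsGloballyMinimal]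

/-- **Tripling on `I₀*` is never along a rational POINT:** at `N = 9p` (`p ≡ 2 (mod 3)`; `exists_isNewformOf`), if `|c₀| = 3|c₁|` and
`ord₃ Δ_min(W₀) = 6`, then the Vélu line `q` along which `W₁ = W₀/C` (p3-g6's rigidity) has `ord₃ D₀(q) = 3` and carries no rational point of
`E_{W₀,1}`. [cite: CesnaviciusNeururerSaha2023, Lemma 6.5] [cite: SilvermanATAEC1994, IV.9.4 Table 4.1] -/
theorem veluLine_not_isShortThreeTorsion_of_tripled_IstarZero (hnf : exists_isNewformOf) {p : ℕ} (hp : p.Prime) (hp3 : p % 3 = 2)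
    [NeZero (9 * p)] (D₁ : Gamma1ParametrizationData W₁ (9 * p)) (D₀ : ModularParametrizationData W₀ (9 * p))
    (hiso : IsIsogenous W₁ W₀) (h₁ : D₁.IsOptimal)
    (h₀ : ∀ z ∈ D₀.L.lattice, ∃ w ∈ periodLattice D₀.f, z = D₀.c * w)
    (hΔ6 : padicValInt 3 W₀.minimalDiscriminantInt = 6) (htri : D₀.maninConstant.natAbs = 3 * D₁.maninConstant.natAbs) :
    ∃ q : ℚ, W₀.Ψ₃.eval (q - W₀.b₂ / 12) = 0 ∧ W₁.c₄ = 1440 * q ^ 2 - 9 * W₀.c₄ ∧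
      W₁.c₆ = 60480 * q ^ 3 - 756 * W₀.c₄ * q - 27 * W₀.c₆ ∧ padicValRat 3 (W₀.Ψ₂Sq.eval (q - W₀.b₂ / 12)) = 3 ∧
      ∀ Y₁ : ℚ, ¬ IsShortThreeTorsion W₀ 1 q Y₁ := by
  obtain ⟨-, q, hq, hc4, hc6, hD⟩ := tripling_profile_IstarZero_nine_mul_prime hnf hp hp3 D₁ D₀ hiso h₁ h₀ hΔ6 htri
  refine ⟨q, hq, hc4, hc6, hD, fun Y₁ hT ↦ ?_⟩
  have heven := even_padicValRat_Ψ₂Sq_of_isShortThreeTorsion W₀ hT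
  rw [hD] at heven
  exact (Int.not_even_iff_odd.mpr (by decide)) heven

end Summit.BirchSwinnertonDyer.BirchSwinnertonDyer.Theorems.ManinLocalTwoThree

end
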